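import Literature.MathematicalPhysics.QuantumFieldTheory.Balaban1983to89.B4Lemma22CrossSup
import Literature.MathematicalPhysics.QuantumFieldTheory.Balaban1983to89.B3GkZeroBoxPointwise

/-!
# B4 p. 581, (2.32) WITHOUT «A′ has a compact support in □»: the cross term `D^{η*}_{A₀}F_{1,k}(−A′)` of `V_k` for a
# perturbation that is regular on `□` but NOT constant near `∂□` — first-order part + interior divergence part + a
# BOUNDARY-LAYER part — and the bound of `D^η_{A₀,ν}G_k(□,A₀)∘(cross term)` at points far from `∂□`

statement-level skeleton of published theorems with citation tags; proofs where landed; nothing here is a claim about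
the Yang–Mills mass gap

**Source.** T. Bałaban, *Regularity and decay of lattice Green's functions*, Commun. Math. Phys. **89** (1983) 571–597
(bib key `Balaban1983RegularityDecay`, «B4» of the 1983–89 series; journal page = PDF page + 570; lit store
`paper:balaban1983-cmp89-regularity-decay`, text layer `p0009.txt`, `p0011.txt`, `p0013.txt`): p. 579 [PDF 9] (2.23),
p. 581 [PDF 11] (2.31)–(2.33), p. 583 [PDF 13] the Remark after (2.39); and T. Bałaban, *(Higgs)₂,₃ quantum fields in a
finite volume. II. An upper bound*, Commun. Math. Phys. **86** (1982) 555–594 (bib key `Balaban1982Higgs2`, «B2»),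
p. 572 [PDF 18] (2.68).  A NEW LEAF over `B4Lemma22CrossSup` (pub-balaban b04 lineage: the sitewise regrouping (2.32) of
the cross term, `cross_site_eq` / `cross_first_le` / `sum_box_nbrs`) and `B3GkZeroBoxPointwise` (lit-balaban p39 g5: the
pointwise kernel estimate of the p. 583 Remark for `G_k(□,0)` and its derivative, `abs_GkDiff_le`); no existing module is
touched; nothing of [B4] is asserted as a fact.  Unit `lit-balaban-r04` gen 18 (B4 second reader), 2026-08-22; serves the
cell's GAPS.md entry G-B2-04 (the input `remD` of `B2Lemma24Proof.Model`, p23).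

## WHAT IS PRINTED (verbatim «…»)

p. 579: «We can write the configuration A as a sum A₀ + A′, where A₀ is a constant configuration, e.g. it is a value
of A at some point of □, and A′ is a small and regular configuration, i.e. we have (2.23) A = A₀ + A′, |A′|, |∂^η_μA′|
≤ c′e^{β−1}, c′ depends on c and M.»
p. 581: «Now we have to choose A₀ more carefully. According to our assumptions Ã is constant in a neighbourhood of
boundary of □, and we choose A₀ equal to this constant. Thus in the decomposition Ã = A₀ + A′, the configuration A′
is regular and has a compact support in □.» … «At first let us observe that V_k can be interpreted as a first order
differential operator acting on a function on the right hand side of it. The only trouble is with the term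
D^{η*}_{A₀}F_{1,k}(−A′), for which it is not a natural interpretation. Using the formula (2.4) and the fact that A′ has
a compact support in □, we have (2.32) … Thus it is a first order differential operator with small coefficients. Only
here we needed the assumption that Ã is constant in a neighbourhood of ∂□. Now using Lemma 2.2 for G_k(□,A₀) and the
decomposition D^η_Ã = U(A′)D^η_{A₀} + F_{1,k}(A′), we have (2.33) … The inequality (2.17) is proved in the same way.»
p. 583: «*Remark.* Let us mention here that the above method can be used also to prove pointwise estimates of G_k(□),
G_k(□, A), and even G_k(Ω, A), their derivatives and "Hölder-derivatives".»
[B2] p. 572: «Using the expansion formula (I.3.44) and Proposition I.2.2. we have (a_kG_k(□, A^{(k)})Q_k^*(A^{(k)})□₁φ)(x)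
= … = (a_kG_k(□, A₀)Q_k^*(A₀)□₁φ)(x) + O((L^kε)^{κ₀}), κ₀ > 0, (2.68) and similarly for the derivative.» — there
`A′ = A^{(k)} − A₀`, `A₀ = A^{(k)}(y)`, is regular on `□` but does NOT vanish near `∂□`.

## WHAT THIS FILE CERTIFIES (kernel-checked, zero `sorry`, no hypotheses beyond the displayed ones; standard axioms)

Setting = the b04 lineage's typed [B4] objects on the fine box `□ = Π_μ[0, nM_μ) ⊂ ℤ^{d+1}`, `n = L^k`, `L = ℓ + 1`
(`B4Lemma22ReduceZero.Box`): the cross term `C = crossOp (boxWt n) W₀ E` of (2.24) (`W₀ = U(κA₀)` the constant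
background `fieldLink F κ (constBond A₀ ·)`, `E = 1 − U(κA′)ᵀ = −ηF_{1,k}(−A′)`, weight `n²/2` per ordered nearest-
neighbour pair of `□` — Neumann conditions (1.3)), the Green's function `G_k(□,A₀) = greenA0` and the covariant
derivative `D^η_{A₀,ν} = derivA0`, for ANY orthogonal one-parameter flow `F` with Lipschitz generator (`ℓ_F`).
* §1 the boundary layer `∂-layer(□) = {z ∈ □ : some lattice neighbour z ± e_μ ∉ □}` = the union of the `2(d+1)` faces
  (`add_e1_not_mem_iff`, `sub_e1_not_mem_iff`, `face_of_bdry`) and the deep points (all coordinates `≥ R` from both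
  faces): `le_supNorm_of_deep` (`|x − z|_∞ ≥ R` for `z` in the layer), `add_e1_mem_of_deep`.
* §2 exponential sums over a face and over the layer: `sum_face_le` (`Σ_{z∈□, z_μ=c} e^{−s|x−z|_∞} ≤
  e^{−(s/(d+1))|x_μ−c|}(2(1−e^{−s/(d+1)})^{−1})^d`, product structure + the tree's one-dimensional geometric sum
  `B4Sect5Proof.sum_exp_neg_abs_le`), `geomInv_le` (`(1−e^{−b})^{−1} ≤ 1 + 1/b`), `sum_bdry_exp_le`.
* §3 **`bdry_kernel_sum_le`** — BOUNDARY-LAYER SOURCES ARE `η`-SMALL IN THE INTERIOR: `∃ δ₁, C > 0` (from `d ≥ 1`, `L`,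
  the window) with `Σ_{z ∈ ∂-layer} n|G_k(□;x+e_ν,z) − G_k(□;x,z)| ≤ C·n^{−1}·e^{−δ₁R}` for every `k ≥ 1`, window point,
  box, depth `R ≥ 1` (unit blocks) and deep `x` — the p. 583-Remark pointwise estimate `B3GkZeroBoxPointwise.abs_GkDiff_le`
  summed over the faces (a face is `d`-dimensional: the tangential series cost `n^d`, absorbed by `|x−z|_∞^{−d} ≤ n^{−d}`).
* §4 `siteNorm_conj_kron_mulVec_le`, **`deriv_green_site_le`**: `|(D^η_{A₀,ν}G_k(□,A₀)f)(x)| ≤ Σ_z|(D^η_νG_k(□))(x,z)|·|f(z)|`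
  — at a constant configuration both operators are conjugates of the colourwise scalar ones by one orthogonal gauge
  transformation (`B4GaugeCovariance.b4Green_constBond`, `B4Lemma22ReduceZero.covDeriv_constBond`).
* §5 the cross term at a site WITHOUT a boundary hypothesis: `cross_fld_eq` (`(CΨ)(z)` = covariant first-order part +
  `(n²/2)Σ_μ` two-neighbour divergence terms), `div_sub_lone_le` (divergence term minus its lone face terms
  `≤ 2ℓ_Fθ′/n²·|ψ(z)|` under the DERIVATIVE bound), `lone_le` (lone face terms `≤ 4ℓ_Fθ/n·|ψ(z)|` under the SIZE bound),
  `lone_eq_zero` (they vanish off the layer).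
* §6 **`deriv_green_cross_le`** (headline) and **`deriv_green_cross_le_field`** (the same with `Σ_μ‖D^η_{Ã,μ}Ψ‖_∞`,
  `Ã = A₀ + A′`, via `B4Lemma22ReduceDeriv.covDeriv_sub_supN_le_nbrs`): for `|κA′_b| ≤ θ/n` (nearest-neighbour bonds) and
  `|κ(A′(b′) − A′(b))| ≤ θ′/n²` (consecutive parallel bonds), NO condition at the faces, every depth `R ≥ 1`, every `x`
  with `Rn ≤ x_i`, `x_i + Rn + 1 ≤ nM_i`, every `ν` and every `N`-component field `Ψ`:
  `|(D^η_{A₀,ν}G_k(□,A₀)CΨ)(x)| ≤ C·ℓ_F·(θ·Σ_μ‖D^η_{A₀,μ}Ψ‖_∞ + θ′·‖Ψ‖_∞ + θ·e^{−δ₁R}·‖Ψ‖_∞)` — the interior part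
  through the zero-field row sums `B4Thm110ZeroBoxDeriv.lemma22_zero_box_deriv_rowSum` ((2.17)_∞ at `A₀`), the face part
  (`|face source| ≤ 2(d+1)ℓ_Fnθ‖Ψ‖_∞` on the layer) through §3.

## DICTIONARY / HONEST SCOPE

(a) Exactly the carrier and hypotheses of `B4Lemma22CrossSup` minus its boundary hypothesis `hbd` («A′ has a compact
support in □», there typed as `A′ = 0` on the bonds touching the faces): the size and derivative bounds are the lattice
forms of (2.23) with free parameters `θ, θ′` (print: both `O(c′e^β)` with `κ = e/n`); constants existential, depending on
`d ≥ 1`, `ℓ` and the window `[a₋,a₊] × [0,m²₊]` (the dependence on `d ≥ 1` comes from `abs_GkDiff_le`; `d + 1 ≥ 2`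
covers [B2]'s `d = 2, 3`).  (b) The statement is POINTWISE at deep points (`dist(x,□ᶜ) ≥ R` in the print's units), not an
operator-norm statement: in `‖·‖_∞ → ‖·‖_∞` the boundary-layer part of `C` is of size `nθ` and `D^η_νG_kD^{η*}_μ` is not
bounded uniformly in `n`; the gain `n^{−1}` comes from measuring the face source by the kernel (codimension one).  (c) Only
the cross term `C` (the printed `D^{η*}_{A₀}F_{1,k}(−A′)`); its transpose `Cᵀ`, the quadratic term and the `a`-terms of
(2.24) are first-order small in `‖·‖_∞` without any boundary hypothesis (`B4Lemma22PertVSup`).  (d) No `(2.31)`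
resummation here: the file bounds ONE application `D_{A₀}G_k(□,A₀)C`, the shape of the (2.68)-remainder derivative in
[B2] Lemma 2.4 (`B2Lemma24Proof.Model.remD` with `Ψ := gVec`); the conversion to `D_Ã` costs `(d+1)ℓ_F²θ²‖Ψ‖_∞`.
(e) Constants explicit in the proofs (`C = (d+1)(c₂ + 2C_b)`, `δ₁ = δ/(2(d+1))` with `δ, C_b` from `abs_GkDiff_le`),
unoptimised.  Value = kernel certificate of our corollary of the printed route; NOT summit progress; 0 new definitions,
0 named facts.
-/

namespace Literature.MathematicalPhysics.QuantumFieldTheory.Balaban1983to89.B4Eq232BoundaryLayer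

open Finset Matrix
open scoped Kronecker
open B4GaugeCovariance (fld OrthFlow fieldLink boxWt blkWt constBond pathEnd blockDiag IsGauge linGauge
  fld_blockDiag_mulVec)
open B4Lower18Regular (e1 pertE crossOp)
open B4Lemma21Region (siteNorm covDeriv)
open B4Reflection242 (nbrs mem_nbrs boxDom mem_boxDom nbrs_comm)
open B4ContourShift (supNorm supNorm_nonneg abs_le_supNorm)
open B4Lemma22Reduce231
open B4Lemma22ReduceZero (siteNorm_sum_le Box gk dk greenA0 derivA0 derivA fld_kron_mulVec siteNorm_kron_row_le
  zero_box_sup sup_hyps_conj covDeriv_constBond isGauge_transpose siteNorm_gauge_mulVec fdiffM_mul_apply_of_mem)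
open B4Lemma22PertVSup
open B4Lemma22CrossSup
open B4Thm110ZeroBox (Nf)
open B4BoxCov237 (boxOpR)

noncomputable section

variable {d : ℕ}

/-! ## §1 The boundary layer of a box and its deep points -/

/-- components of `z ± e_μ`. [folklore] -/
private theorem add_e1_apply (z : Fin (d + 1) → ℤ) (μ i : Fin (d + 1)) :
    (z + e1 μ) i = z i + (if i = μ then 1 else 0) := by
  by_cases h : i = μ
  · subst h; simp [e1]
  · simp [e1, h]

/-- components of `z − e_μ`. [folklore] -/
private theorem sub_e1_apply (z : Fin (d + 1) → ℤ) (μ i : Fin (d + 1)) :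
    (z - e1 μ) i = z i - (if i = μ then 1 else 0) := by
  by_cases h : i = μ
  · subst h; simp [e1]
  · simp [e1, h]

/-- the forward `μ`-neighbour of a box site leaves the box iff the site lies on the upper `μ`-face.
[folklore] -/
private theorem add_e1_not_mem_iff {N : Fin (d + 1) → ℕ} {z : Fin (d + 1) → ℤ} (hz : z ∈ boxDom N) (μ : Fin (d + 1)) :
    z + e1 μ ∉ boxDom N ↔ (N μ : ℤ) ≤ z μ + 1 := by
  rw [mem_boxDom] at hz ⊢
  constructor
  · intro h
    by_contra hlt
    push Not at hlt
    apply h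
    intro i
    rw [add_e1_apply]
    by_cases hi : i = μ
    · subst hi
      rw [if_pos rfl]
      exact ⟨by linarith [(hz i).1], hlt⟩
    · rw [if_neg hi, add_zero]
      exact hz i
  · intro hle hmem
    have h2 := (hmem μ).2
    rw [add_e1_apply, if_pos rfl] at h2
    linarith

/-- the backward `μ`-neighbour of a box site leaves the box iff the site lies on the lower `μ`-face.
[folklore] -/
private theorem sub_e1_not_mem_iff {N : Fin (d + 1) → ℕ} {z : Fin (d + 1) → ℤ} (hz : z ∈ boxDom N) (μ : Fin (d + 1)) :
    z - e1 μ ∉ boxDom N ↔ z μ ≤ 0 := by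
  rw [mem_boxDom] at hz ⊢
  constructor
  · intro h
    by_contra hlt
    push Not at hlt
    apply h
    intro i
    rw [sub_e1_apply]
    by_cases hi : i = μ
    · subst hi
      rw [if_pos rfl]
      exact ⟨by linarith, by linarith [(hz i).2]⟩
    · rw [if_neg hi, sub_zero]
      exact hz i
  · intro hle hmem
    have h2 := (hmem μ).1
    rw [sub_e1_apply, if_pos rfl] at h2
    linarith

/-- **BOUNDARY-LAYER SITES ARE FAR FROM DEEP POINTS**: if every coordinate of `x` is at least `R` away from
both `μ`-faces of the box and `z` is a box site with a missing lattice neighbour, then `|x − z|_∞ ≥ R`.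
[folklore] -/
private theorem le_supNorm_of_deep {N : Fin (d + 1) → ℕ} {R : ℕ} {x z : Fin (d + 1) → ℤ}
    (hx : ∀ i, (R : ℤ) ≤ x i ∧ x i + R + 1 ≤ N i) (hz : z ∈ boxDom N)
    (hb : ∃ μ, z + e1 μ ∉ boxDom N ∨ z - e1 μ ∉ boxDom N) : (R : ℝ) ≤ supNorm (x - z) := by
  obtain ⟨μ, h | h⟩ := hb
  · rw [add_e1_not_mem_iff hz] at h
    have hzμ := (mem_boxDom.1 hz μ).2
    have h1 : (R : ℤ) ≤ |(x - z) μ| := by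
      rw [Pi.sub_apply, le_abs]
      right
      linarith [(hx μ).2]
    have h2 : ((R : ℤ) : ℝ) ≤ ((|(x - z) μ| : ℤ) : ℝ) := by exact_mod_cast h1
    exact (by push_cast at h2 ⊢; exact h2 : (R : ℝ) ≤ _).trans (abs_le_supNorm (x - z) μ)
  · rw [sub_e1_not_mem_iff hz] at h
    have hzμ := (mem_boxDom.1 hz μ).1
    have h1 : (R : ℤ) ≤ |(x - z) μ| := by
      rw [Pi.sub_apply, le_abs]
      left
      linarith [(hx μ).1]
    have h2 : ((R : ℤ) : ℝ) ≤ ((|(x - z) μ| : ℤ) : ℝ) := by exact_mod_cast h1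
    exact (by push_cast at h2 ⊢; exact h2 : (R : ℝ) ≤ _).trans (abs_le_supNorm (x - z) μ)

/-- a boundary-layer site lies on a lower face (`z_μ = 0`) or an upper face (`z_μ = N_μ − 1`). [folklore] -/
private theorem face_of_bdry {N : Fin (d + 1) → ℕ} {z : Fin (d + 1) → ℤ} (hz : z ∈ boxDom N)
    (hb : ∃ μ, z + e1 μ ∉ boxDom N ∨ z - e1 μ ∉ boxDom N) :
    ∃ μ, z μ = 0 ∨ z μ = (N μ : ℤ) - 1 := by
  obtain ⟨μ, h | h⟩ := hb
  · rw [add_e1_not_mem_iff hz] at h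
    have := (mem_boxDom.1 hz μ).2
    exact ⟨μ, Or.inr (by omega)⟩
  · rw [sub_e1_not_mem_iff hz] at h
    have := (mem_boxDom.1 hz μ).1
    exact ⟨μ, Or.inl (by omega)⟩

/-- the forward neighbour of a deep point (depth `R ≥ 1`) is in the box. [folklore] -/
private theorem add_e1_mem_of_deep {N : Fin (d + 1) → ℕ} {R : ℕ} (hR : 1 ≤ R) {x : Fin (d + 1) → ℤ}
    (hx : ∀ i, (R : ℤ) ≤ x i ∧ x i + R + 1 ≤ N i) (ν : Fin (d + 1)) : x + e1 ν ∈ boxDom N := by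
  rw [mem_boxDom]
  intro i
  rw [add_e1_apply]
  have h := hx i
  have hR' : (1 : ℤ) ≤ R := by exact_mod_cast hR
  by_cases hi : i = ν
  · rw [if_pos hi]; constructor <;> linarith
  · rw [if_neg hi]; constructor <;> linarith

/-! ## §2 Exponential sums over a face of a box -/

/-- `(1 − e^{−b})^{−1} ≤ 1 + b^{−1}` for `b > 0` (from `1 + b ≤ e^b`). [folklore] -/
private theorem geomInv_le {b : ℝ} (hb : 0 < b) : (1 - Real.exp (-b))⁻¹ ≤ 1 + b⁻¹ := by
  have h2 : Real.exp (-b) ≤ (1 + b)⁻¹ := by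
    rw [Real.exp_neg, inv_le_inv₀ (Real.exp_pos b) (by positivity)]
    linarith [Real.add_one_le_exp b]
  have h3 : 0 < 1 - (1 + b)⁻¹ := by
    have : (1 + b)⁻¹ < 1 := inv_lt_one_of_one_lt₀ (by linarith)
    linarith
  have hb0 : b ≠ 0 := hb.ne'
  have hb1 : 1 + b ≠ 0 := by positivity
  have e2 : (1 : ℝ) - (1 + b)⁻¹ = b / (1 + b) := by
    rw [eq_div_iff hb1, sub_mul, inv_mul_cancel₀ hb1, one_mul]
    ring
  calc (1 - Real.exp (-b))⁻¹ ≤ (1 - (1 + b)⁻¹)⁻¹ := inv_anti₀ h3 (by linarith)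
    _ = 1 + b⁻¹ := by
        rw [e2, inv_div, add_div, div_self hb0, one_div, add_comm]

/-- **THE EXPONENTIAL SUM OVER ONE FACE OF A BOX**: for a rate `s > 0`, a point `x` and the face
`{z ∈ □ : z_μ = c}`, `Σ_{z} e^{−s|x−z|_∞} ≤ e^{−(s/(d+1))|x_μ − c|}·(2(1 − e^{−s/(d+1)})^{−1})^d` — the sup norm
dominates each coordinate, the face is a product set, and each tangential factor is a two-sided geometric series
(`B4Sect5Proof.sum_exp_neg_abs_le`). [folklore] -/
private theorem sum_face_le (N : Fin (d + 1) → ℕ) (μ : Fin (d + 1)) (c : ℤ) (x : Fin (d + 1) → ℤ) {s : ℝ}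
    (hs : 0 < s) :
    ∑ z ∈ (boxDom N).filter (fun z => z μ = c), Real.exp (-(s * supNorm (x - z)))
      ≤ Real.exp (-(s / (d + 1) * |(x μ : ℝ) - c|)) * (2 * (1 - Real.exp (-(s / (d + 1))))⁻¹) ^ d := by
  classical
  set s' : ℝ := s / (d + 1) with hs'
  have hs'0 : 0 < s' := by rw [hs']; positivity
  set g : Fin (d + 1) → ℤ → ℝ := fun i m => Real.exp (-(s' * |(x i : ℝ) - m|)) with hg
  have hg0 : ∀ i m, 0 ≤ g i m := fun i m => (Real.exp_pos _).le
  -- each term is dominated by the product of the coordinate factors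
  have hterm : ∀ z : Fin (d + 1) → ℤ, Real.exp (-(s * supNorm (x - z))) ≤ ∏ i, g i (z i) := by
    intro z
    refine (B4TorusKernel.exp_supNorm_le_prod hs.le (x - z)).trans (le_of_eq ?_)
    refine Finset.prod_congr rfl fun i _ => ?_
    simp only [hg, hs', Pi.sub_apply]
    push_cast
    ring_nf
  -- the face is contained in a product set
  set t : Fin (d + 1) → Finset ℤ := fun i => if i = μ then {c} else Finset.Ico 0 (N i) with ht
  have hsub : (boxDom N).filter (fun z => z μ = c) ⊆ Fintype.piFinset t := by
    intro z hz
    rw [Finset.mem_filter] at hz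
    rw [Fintype.mem_piFinset]
    intro i
    by_cases hi : i = μ
    · subst hi
      rw [ht]
      simp only [if_true, Finset.mem_singleton]
      exact hz.2
    · rw [ht]
      simp only [hi, if_false]
      have := (mem_boxDom.1 hz.1) i
      exact Finset.mem_Ico.2 ⟨this.1, this.2⟩
  -- the coordinate factors
  set B : ℝ := 2 * (1 - Real.exp (-s'))⁻¹ with hB
  have hB0 : 0 ≤ B := by
    have : Real.exp (-s') < 1 := Real.exp_lt_one_iff.2 (by linarith)
    rw [hB]
    exact mul_nonneg (by norm_num) (inv_nonneg.2 (by linarith))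
  set b : Fin (d + 1) → ℝ := fun i => if i = μ then Real.exp (-(s' * |(x μ : ℝ) - c|)) else B with hb
  have hfac : ∀ i, ∑ m ∈ t i, g i m ≤ b i := by
    intro i
    by_cases hi : i = μ
    · subst hi
      simp only [ht, hb, if_true, Finset.sum_singleton, hg]
      exact le_rfl
    · simp only [ht, hb, hi, if_false, hg]
      exact B4Sect5Proof.sum_exp_neg_abs_le _ _ hs'0
  have hprod : ∏ i, b i = Real.exp (-(s' * |(x μ : ℝ) - c|)) * B ^ d := by
    rw [← Finset.mul_prod_erase Finset.univ b (Finset.mem_univ μ)]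
    have h1 : b μ = Real.exp (-(s' * |(x μ : ℝ) - c|)) := by simp only [hb, if_true]
    have h2 : ∏ i ∈ Finset.univ.erase μ, b i = ∏ _i ∈ Finset.univ.erase μ, B :=
      Finset.prod_congr rfl fun i hi => by
        simp only [hb, Finset.ne_of_mem_erase hi, if_false]
    rw [h1, h2, Finset.prod_const, Finset.card_erase_of_mem (Finset.mem_univ μ), Finset.card_univ,
      Fintype.card_fin, Nat.add_sub_cancel]
  calc ∑ z ∈ (boxDom N).filter (fun z => z μ = c), Real.exp (-(s * supNorm (x - z)))
      ≤ ∑ z ∈ (boxDom N).filter (fun z => z μ = c), ∏ i, g i (z i) :=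
        Finset.sum_le_sum fun z _ => hterm z
    _ ≤ ∑ z ∈ Fintype.piFinset t, ∏ i, g i (z i) :=
        Finset.sum_le_sum_of_subset_of_nonneg hsub fun z _ _ => Finset.prod_nonneg fun i _ => hg0 i (z i)
    _ = ∏ i, ∑ m ∈ t i, g i m := (Finset.prod_univ_sum t (fun i m => g i m)).symm
    _ ≤ ∏ i, b i := Finset.prod_le_prod (fun i _ => Finset.sum_nonneg fun m _ => hg0 i m) fun i _ => hfac i
    _ = _ := by rw [hprod]

/-- **THE EXPONENTIAL SUM OVER THE WHOLE BOUNDARY LAYER, SEEN FROM A DEEP POINT**: if every coordinate of `x`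
is at least `D` away from both faces, then `Σ_{z ∈ ∂-layer} e^{−s|x−z|_∞} ≤ 2(d+1)·e^{−(s/(d+1))D}·(2(1 − e^{−s/(d+1)})^{−1})^d`
(the layer is covered by the `2(d+1)` faces). [folklore] -/
private theorem sum_bdry_exp_le (N : Fin (d + 1) → ℕ) {D : ℕ} {x : Fin (d + 1) → ℤ}
    (hx : ∀ i, (D : ℤ) ≤ x i ∧ x i + D + 1 ≤ N i) {s : ℝ} (hs : 0 < s) :
    ∑ z : ↥(boxDom N), (if (∃ μ, z.1 + e1 μ ∉ boxDom N ∨ z.1 - e1 μ ∉ boxDom N) then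
        Real.exp (-(s * supNorm (x - z.1))) else 0)
      ≤ 2 * ((d : ℝ) + 1) * (Real.exp (-(s / (d + 1) * D)) * (2 * (1 - Real.exp (-(s / (d + 1))))⁻¹) ^ d) := by
  classical
  set f : (Fin (d + 1) → ℤ) → ℝ := fun z => Real.exp (-(s * supNorm (x - z))) with hf
  have hf0 : ∀ z, 0 ≤ f z := fun z => (Real.exp_pos _).le
  set K : ℝ := Real.exp (-(s / (d + 1) * D)) * (2 * (1 - Real.exp (-(s / (d + 1))))⁻¹) ^ d with hK
  have hB0 : 0 ≤ 2 * (1 - Real.exp (-(s / (d + 1))))⁻¹ := by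
    have : Real.exp (-(s / (d + 1))) < 1 := Real.exp_lt_one_iff.2 (by
      have : 0 < s / (d + 1) := by positivity
      linarith)
    exact mul_nonneg (by norm_num) (inv_nonneg.2 (by linarith))
  -- one face
  have hface : ∀ (μ : Fin (d + 1)) (c : ℤ), (D : ℤ) ≤ |x μ - c| →
      ∑ z : ↥(boxDom N), (if z.1 μ = c then f z.1 else 0) ≤ K := by
    intro μ c hc
    rw [Finset.sum_coe_sort (boxDom N) (fun z => if z μ = c then f z else 0), ← Finset.sum_filter]
    refine (sum_face_le N μ c x hs).trans ?_
    rw [hK]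
    refine mul_le_mul_of_nonneg_right ?_ (pow_nonneg hB0 d)
    rw [Real.exp_le_exp, neg_le_neg_iff]
    refine mul_le_mul_of_nonneg_left ?_ (by positivity)
    have : ((D : ℤ) : ℝ) ≤ ((|x μ - c| : ℤ) : ℝ) := by exact_mod_cast hc
    push_cast at this
    exact this
  -- the layer is covered by the faces
  have hcover : ∀ z : ↥(boxDom N),
      (if (∃ μ, z.1 + e1 μ ∉ boxDom N ∨ z.1 - e1 μ ∉ boxDom N) then f z.1 else 0)
        ≤ ∑ μ, ((if z.1 μ = 0 then f z.1 else 0) + (if z.1 μ = (N μ : ℤ) - 1 then f z.1 else 0)) := by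
    intro z
    have hnn : ∀ μ, 0 ≤ (if z.1 μ = 0 then f z.1 else 0) + (if z.1 μ = (N μ : ℤ) - 1 then f z.1 else 0) :=
      fun μ => add_nonneg (by split_ifs <;> simp [hf0]) (by split_ifs <;> simp [hf0])
    split_ifs with hb
    · obtain ⟨μ, hμ⟩ := face_of_bdry z.2 hb
      refine le_trans ?_ (Finset.single_le_sum (fun μ _ => hnn μ) (Finset.mem_univ μ))
      rcases hμ with h | h
      · rw [if_pos h]
        have : 0 ≤ (if z.1 μ = (N μ : ℤ) - 1 then f z.1 else 0) := by split_ifs <;> simp [hf0]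
        linarith
      · rw [if_pos h]
        by_cases h' : z.1 μ = 0
        · rw [if_pos h']; linarith [hf0 z.1]
        · rw [if_neg h']; linarith
    · exact Finset.sum_nonneg fun μ _ => hnn μ
  calc ∑ z : ↥(boxDom N), (if (∃ μ, z.1 + e1 μ ∉ boxDom N ∨ z.1 - e1 μ ∉ boxDom N) then f z.1 else 0)
      ≤ ∑ z : ↥(boxDom N), ∑ μ, ((if z.1 μ = 0 then f z.1 else 0)
          + (if z.1 μ = (N μ : ℤ) - 1 then f z.1 else 0)) := Finset.sum_le_sum fun z _ => hcover z
    _ = ∑ μ, (∑ z : ↥(boxDom N), (if z.1 μ = 0 then f z.1 else 0)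
          + ∑ z : ↥(boxDom N), (if z.1 μ = (N μ : ℤ) - 1 then f z.1 else 0)) := by
        rw [Finset.sum_comm]
        exact Finset.sum_congr rfl fun μ _ => Finset.sum_add_distrib
    _ ≤ ∑ _μ : Fin (d + 1), (K + K) := by
        refine Finset.sum_le_sum fun μ _ => add_le_add (hface μ 0 ?_) (hface μ _ ?_)
        · rw [sub_zero]
          exact le_abs.2 (Or.inl (hx μ).1)
        · exact le_abs.2 (Or.inr (by linarith [(hx μ).2]))
    _ = 2 * ((d : ℝ) + 1) * K := by
        rw [Finset.sum_const, Finset.card_univ, Fintype.card_fin, nsmul_eq_mul]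
        push_cast
        ring

/-! ## §3 The derivative kernel of the zero-field box Green's function summed over the boundary layer -/

/-- **BOUNDARY-LAYER SOURCES ARE `η`-SMALL IN THE INTERIOR**: there are `δ₁, C > 0` (depending on `d ≥ 1`, `L = ℓ+1`
and the window only) such that for every scale `k ≥ 1` (`n = L^k` fine points per unit length), every point of the
window, every box, every depth `R ≥ 1` (in unit blocks) and every fine site `x` whose coordinates are at least `Rn` away
from all faces,  `Σ_{z ∈ ∂-layer(□)} n·|G_k(□;x+e_ν,z) − G_k(□;x,z)| ≤ C·n^{-1}·e^{−δ₁R}`,  `G_k(□) = (−Δ^{η,N}_□ + m² +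
a_kP_k)^{-1}` at `A = 0` — from the pointwise kernel estimate of the p. 583 Remark («the above method can be used also to
prove pointwise estimates of G_k(□) … their derivatives») in the tree form `B3GkZeroBoxPointwise.abs_GkDiff_le`
(`n|G(x+e_ν,z) − G(x,z)| ≤ C·n^{-1}·|x−z|_∞^{−d}·e^{−δ|x−z|_∞/L^{k−1}}`), summed over the `2(d+1)` faces (§2): a face is
`(d)`-dimensional, so the tangential geometric series cost `n^d`, which the factor `|x−z|_∞^{−d} ≤ n^{−d}` absorbs.
[cite: Balaban1983RegularityDecay, p. 583 Remark; (1.10) p. 573] -/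
theorem bdry_kernel_sum_le (d ℓ : ℕ) (hd : 1 ≤ d) (hℓ : 1 ≤ ℓ) (amin aplus m2plus : ℝ) (ha : 0 < amin) :
    ∃ δ₁ C : ℝ, 0 < δ₁ ∧ 0 < C ∧ ∀ (k : ℕ), 1 ≤ k → ∀ (a m2 : ℝ), amin ≤ a → a ≤ aplus → 0 ≤ m2 → m2 ≤ m2plus →
      ∀ (M : Fin (d + 1) → ℕ), (∀ i, 1 ≤ M i) → ∀ (R : ℕ), 1 ≤ R →
        ∀ (ν : Fin (d + 1)) (x xe : ↥(boxDom (Nf ℓ k M))), xe.1 = x.1 + Pi.single ν 1 →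
        (∀ i, ((R * (ℓ + 1) ^ k : ℕ) : ℤ) ≤ x.1 i ∧ x.1 i + (R * (ℓ + 1) ^ k : ℕ) + 1 ≤ (Nf ℓ k M i : ℤ)) →
          ∑ z : ↥(boxDom (Nf ℓ k M)), (if (∃ μ, z.1 + e1 μ ∉ boxDom (Nf ℓ k M) ∨ z.1 - e1 μ ∉ boxDom (Nf ℓ k M)) then
              (((ℓ + 1) ^ k : ℕ) : ℝ) *
                |(boxOpR ((ℓ + 1) ^ k) (B1.aSeq a ((ℓ : ℝ) + 1) k) m2 M)⁻¹ xe z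
                  - (boxOpR ((ℓ + 1) ^ k) (B1.aSeq a ((ℓ : ℝ) + 1) k) m2 M)⁻¹ x z| else 0)
            ≤ C * ((((ℓ + 1) ^ k : ℕ) : ℝ))⁻¹ * Real.exp (-(δ₁ * R)) := by
  classical
  obtain ⟨δ, C₀, hδ, hC₀, hK⟩ := B3GkZeroBoxPointwise.abs_GkDiff_le d ℓ hd hℓ amin aplus m2plus ha
  set A : ℝ := 2 * (1 + 2 * ((d : ℝ) + 1) / δ) with hA
  have hA1 : 1 ≤ A := by
    rw [hA]
    have : 0 ≤ 2 * ((d : ℝ) + 1) / δ := by positivity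
    linarith
  refine ⟨δ / (2 * ((d : ℝ) + 1)), 2 * ((d : ℝ) + 1) * C₀ * A ^ d, by positivity, by positivity, ?_⟩
  intro k hk a m2 h1 h2 h3 h4 M hM R hR ν x xe hxe hx
  set n : ℕ := (ℓ + 1) ^ k with hn
  set G := (boxOpR n (B1.aSeq a ((ℓ : ℝ) + 1) k) m2 M)⁻¹ with hG
  have hn1 : 1 ≤ n := Nat.one_le_pow _ _ (by omega)
  have hnR : (1 : ℝ) ≤ (n : ℝ) := by exact_mod_cast hn1
  have hn0 : (0 : ℝ) < (n : ℝ) := by linarith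
  have hL1 : (1 : ℝ) ≤ (ℓ : ℝ) + 1 := by
    have : (0 : ℝ) ≤ (ℓ : ℝ) := Nat.cast_nonneg ℓ
    linarith
  have hncast : (n : ℝ) = ((ℓ : ℝ) + 1) ^ k := by rw [hn]; push_cast; ring
  -- `L^{k-1} ≤ n` and `1 ≤ L^{k-1}`
  have hLk1 : (1 : ℝ) ≤ ((ℓ : ℝ) + 1) ^ (k - 1) := one_le_pow₀ hL1
  have hLkn : ((ℓ : ℝ) + 1) ^ (k - 1) ≤ (n : ℝ) := by
    rw [hncast]
    exact pow_le_pow_right₀ hL1 (Nat.sub_le k 1)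
  have hLk0 : (0 : ℝ) < ((ℓ : ℝ) + 1) ^ (k - 1) := by positivity
  -- the rate of the face sums and its geometric constant
  set s : ℝ := δ / 2 / ((ℓ : ℝ) + 1) ^ (k - 1) with hs
  have hs0 : 0 < s := by positivity
  set s' : ℝ := s / (d + 1) with hs'
  have hs'0 : 0 < s' := by positivity
  have hBle : 2 * (1 - Real.exp (-s'))⁻¹ ≤ A * n := by
    have hg := geomInv_le hs'0
    have hs'inv : s'⁻¹ = 2 * ((d : ℝ) + 1) / δ * ((ℓ : ℝ) + 1) ^ (k - 1) := by
      rw [hs', hs]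
      field_simp
    have h1 : (1 - Real.exp (-s'))⁻¹ ≤ (1 + 2 * ((d : ℝ) + 1) / δ) * n := by
      calc (1 - Real.exp (-s'))⁻¹ ≤ 1 + s'⁻¹ := hg
        _ = 1 + 2 * ((d : ℝ) + 1) / δ * ((ℓ : ℝ) + 1) ^ (k - 1) := by rw [hs'inv]
        _ ≤ 1 * (n : ℝ) + 2 * ((d : ℝ) + 1) / δ * n := by
            refine add_le_add (by linarith) (mul_le_mul_of_nonneg_left hLkn (by positivity))
        _ = (1 + 2 * ((d : ℝ) + 1) / δ) * n := by ring
    calc 2 * (1 - Real.exp (-s'))⁻¹ ≤ 2 * ((1 + 2 * ((d : ℝ) + 1) / δ) * n) :=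
          mul_le_mul_of_nonneg_left h1 (by norm_num)
      _ = A * n := by rw [hA]; ring
  have hB0 : 0 ≤ 2 * (1 - Real.exp (-s'))⁻¹ := by
    have : Real.exp (-s') < 1 := Real.exp_lt_one_iff.2 (by linarith)
    exact mul_nonneg (by norm_num) (inv_nonneg.2 (by linarith))
  -- the depth in fine units and the exponential factor
  have hdeep : ∀ i, (((R * n : ℕ)) : ℤ) ≤ x.1 i ∧ x.1 i + ((R * n : ℕ) : ℤ) + 1 ≤ (Nf ℓ k M i : ℤ) := hx
  have hexpD : Real.exp (-(s / (d + 1) * ((R * n : ℕ) : ℝ))) ≤ Real.exp (-(δ / (2 * ((d : ℝ) + 1)) * R)) := by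
    rw [Real.exp_le_exp, neg_le_neg_iff]
    have hR0 : (0 : ℝ) ≤ R := Nat.cast_nonneg R
    have e1 : s / (d + 1) * ((R * n : ℕ) : ℝ) = δ / (2 * ((d : ℝ) + 1)) * R * ((n : ℝ) / ((ℓ : ℝ) + 1) ^ (k - 1)) := by
      rw [hs]
      push_cast
      field_simp
    rw [e1]
    have hq : 1 ≤ (n : ℝ) / ((ℓ : ℝ) + 1) ^ (k - 1) := by rwa [le_div_iff₀ hLk0, one_mul]
    calc δ / (2 * ((d : ℝ) + 1)) * R = δ / (2 * ((d : ℝ) + 1)) * R * 1 := (mul_one _).symm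
      _ ≤ δ / (2 * ((d : ℝ) + 1)) * R * ((n : ℝ) / ((ℓ : ℝ) + 1) ^ (k - 1)) :=
          mul_le_mul_of_nonneg_left hq (by positivity)
  -- pointwise: the kernel bound on the layer
  have hxe' : xe.1 = x.1 + Pi.single ν 1 := hxe
  have hpt : ∀ z : ↥(boxDom (Nf ℓ k M)), (∃ μ, z.1 + e1 μ ∉ boxDom (Nf ℓ k M) ∨ z.1 - e1 μ ∉ boxDom (Nf ℓ k M)) →
      (n : ℝ) * |G xe z - G x z| ≤ C₀ * (n : ℝ)⁻¹ * ((n : ℝ) ^ d)⁻¹ * Real.exp (-(s * supNorm (x.1 - z.1))) := by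
    intro z hz
    have hdist : ((R * n : ℕ) : ℝ) ≤ supNorm (x.1 - z.1) := le_supNorm_of_deep hdeep z.2 hz
    have hRn1 : (n : ℝ) ≤ ((R * n : ℕ) : ℝ) := by
      have : (1 : ℝ) ≤ R := by exact_mod_cast hR
      push_cast
      nlinarith
    have hsn : (n : ℝ) ≤ supNorm (x.1 - z.1) := hRn1.trans hdist
    have hspos : 0 < supNorm (x.1 - z.1) := lt_of_lt_of_le hn0 hsn
    have hne : x.1 ≠ z.1 := by
      intro h
      rw [h, sub_self, B4BoxCov237.supNorm_zero'] at hspos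
      exact lt_irrefl _ hspos
    have hk0 := hK k hk a m2 h1 h2 h3 h4 M hM ν x xe hxe' z hne
    rw [← hncast] at hk0
    have hinv : (supNorm (x.1 - z.1))⁻¹ ^ d ≤ ((n : ℝ) ^ d)⁻¹ := by
      rw [← inv_pow]
      exact pow_le_pow_left₀ (inv_nonneg.2 (supNorm_nonneg _)) (inv_anti₀ hn0 hsn) d
    have hexp : Real.exp (-(δ / 2 * (supNorm (x.1 - z.1) / ((ℓ : ℝ) + 1) ^ (k - 1))))
        = Real.exp (-(s * supNorm (x.1 - z.1))) := by
      rw [hs]; ring_nf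
    calc (n : ℝ) * |G xe z - G x z|
        ≤ C₀ * (n : ℝ)⁻¹ * (supNorm (x.1 - z.1))⁻¹ ^ d
            * Real.exp (-(δ / 2 * (supNorm (x.1 - z.1) / ((ℓ : ℝ) + 1) ^ (k - 1)))) := hk0
      _ ≤ C₀ * (n : ℝ)⁻¹ * ((n : ℝ) ^ d)⁻¹
            * Real.exp (-(δ / 2 * (supNorm (x.1 - z.1) / ((ℓ : ℝ) + 1) ^ (k - 1)))) :=
          mul_le_mul_of_nonneg_right (mul_le_mul_of_nonneg_left hinv (by positivity)) (Real.exp_pos _).le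
      _ = _ := by rw [hexp]
  -- summing over the layer
  have hsum := sum_bdry_exp_le (Nf ℓ k M) hdeep hs0
  calc ∑ z : ↥(boxDom (Nf ℓ k M)), (if (∃ μ, z.1 + e1 μ ∉ boxDom (Nf ℓ k M) ∨ z.1 - e1 μ ∉ boxDom (Nf ℓ k M)) then
          (n : ℝ) * |G xe z - G x z| else 0)
      ≤ ∑ z : ↥(boxDom (Nf ℓ k M)), (if (∃ μ, z.1 + e1 μ ∉ boxDom (Nf ℓ k M) ∨ z.1 - e1 μ ∉ boxDom (Nf ℓ k M)) then
          C₀ * (n : ℝ)⁻¹ * ((n : ℝ) ^ d)⁻¹ * Real.exp (-(s * supNorm (x.1 - z.1))) else 0) := by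
        refine Finset.sum_le_sum fun z _ => ?_
        split_ifs with hz
        · exact hpt z hz
        · exact le_rfl
    _ = C₀ * (n : ℝ)⁻¹ * ((n : ℝ) ^ d)⁻¹ *
          ∑ z : ↥(boxDom (Nf ℓ k M)), (if (∃ μ, z.1 + e1 μ ∉ boxDom (Nf ℓ k M) ∨ z.1 - e1 μ ∉ boxDom (Nf ℓ k M))
            then Real.exp (-(s * supNorm (x.1 - z.1))) else 0) := by
        rw [Finset.mul_sum]
        exact Finset.sum_congr rfl fun z _ => by split_ifs <;> simp
    _ ≤ C₀ * (n : ℝ)⁻¹ * ((n : ℝ) ^ d)⁻¹ *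
          (2 * ((d : ℝ) + 1) * (Real.exp (-(s / (d + 1) * ((R * n : ℕ) : ℕ))) * (2 * (1 - Real.exp (-(s / (d + 1))))⁻¹) ^ d)) :=
        mul_le_mul_of_nonneg_left hsum (by positivity)
    _ ≤ C₀ * (n : ℝ)⁻¹ * ((n : ℝ) ^ d)⁻¹ *
          (2 * ((d : ℝ) + 1) * (Real.exp (-(δ / (2 * ((d : ℝ) + 1)) * R)) * (A * n) ^ d)) := by
        refine mul_le_mul_of_nonneg_left (mul_le_mul_of_nonneg_left ?_ (by positivity)) (by positivity)
        exact mul_le_mul hexpD (pow_le_pow_left₀ hB0 hBle d) (pow_nonneg hB0 d) (Real.exp_pos _).le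
    _ = 2 * ((d : ℝ) + 1) * C₀ * A ^ d * ((n : ℝ))⁻¹ * Real.exp (-(δ / (2 * ((d : ℝ) + 1)) * R)) := by
        have hnd : ((n : ℝ) ^ d) ≠ 0 := by positivity
        rw [mul_pow]
        field_simp

/-! ## §4 The kernel of `D^η_{A₀,ν}G_k(□,A₀)` at a constant configuration: entrywise domination by the scalar
zero-field kernel `D^η_νG_k(□)` (gauge conjugation by orthogonal blocks) -/

section Lift

variable {ι : Type} [Fintype ι] [DecidableEq ι]

/-- `|((𝒢(S⊗1)𝒢ᵀ)Φ)(x)| ≤ Σ_z |S(x,z)|·|φ(z)|` for a gauge transformation `𝒢` (orthogonal blocks) and a scalar kernel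
`S`. [folklore] -/
private theorem siteNorm_conj_kron_mulVec_le {X : Type*} [Fintype X] [DecidableEq X] {g : X → Matrix ι ι ℝ}
    (hg : IsGauge g) (S : Matrix X X ℝ) (Φ : X × ι → ℝ) (x : X) :
    siteNorm (fld ((blockDiag g * (S ⊗ₖ (1 : Matrix ι ι ℝ)) * (blockDiag g)ᵀ) *ᵥ Φ) x)
      ≤ ∑ z, |S x z| * siteNorm (fld Φ z) := by
  rw [← mulVec_mulVec, ← mulVec_mulVec, fld_blockDiag_mulVec, siteNorm_gauge_mulVec hg]
  refine (siteNorm_kron_row_le S _ x).trans (le_of_eq (Finset.sum_congr rfl fun z _ => ?_))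
  rw [B4GaugeCovariance.blockDiag_transpose, fld_blockDiag_mulVec, siteNorm_gauge_mulVec (isGauge_transpose hg)]

variable {d : ℕ}

/-- **THE KERNEL OF `D^η_{A₀,ν}G_k(□,A₀)` IS DOMINATED ENTRYWISE BY THE SCALAR KERNEL `D^η_νG_k(□)`**:
`|(D^η_{A₀,ν}G_k(□,A₀)f)(x)| ≤ Σ_z |(D^η_νG_k(□))(x,z)|·|f(z)|` — at a constant configuration both operators are
conjugates of the colourwise scalar operators by the same orthogonal gauge transformation
(`B4GaugeCovariance.b4Green_constBond`, `B4Lemma22ReduceZero.covDeriv_constBond`: «Lemma 2.2 in the case of a constant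
configuration A₀ is equivalent to the case of configuration A₀ = 0 by the same argument with the gauge
transformation»). [cite: Balaban1983RegularityDecay, pp. 581–582] -/
theorem deriv_green_site_le (F : OrthFlow ι) (κ : ℝ) {ℓ k : ℕ} (hℓ : 1 ≤ ℓ) (hk : 1 ≤ k) {a m2 : ℝ} (ha : 0 < a)
    (hm : 0 ≤ m2) {M : Fin (d + 1) → ℕ} (hM : ∀ i, 1 ≤ M i)
    {emb : ↥(boxDom M) → ↥(Box d ℓ k M)} {Γ : ↥(boxDom M) → ↥(Box d ℓ k M) → List ↥(Box d ℓ k M)}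
    (hend : ∀ y x, blkWt ((ℓ + 1) ^ k) M (fun i => (ℓ + 1) ^ k * M i) y x ≠ 0 → pathEnd (emb y) (Γ y x) = x)
    (A₀ : Fin (d + 1) → ℝ) (ν : Fin (d + 1)) (f : ↥(Box d ℓ k M) × ι → ℝ) (x : ↥(Box d ℓ k M)) :
    siteNorm (fld (derivA0 d F κ ℓ k M A₀ ν *ᵥ (greenA0 d F κ ℓ k a m2 M emb Γ A₀ *ᵥ f)) x)
      ≤ ∑ z, |(dk d ℓ k M ν * gk d ℓ k a m2 M) x z| * siteNorm (fld f z) := by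
  have hL : (1 : ℝ) < (ℓ : ℝ) + 1 := by
    have : (1 : ℝ) ≤ (ℓ : ℝ) := by exact_mod_cast hℓ
    linarith
  have hak : 0 < B1.aSeq a ((ℓ : ℝ) + 1) k := B1.aSeq_pos ha hL hk
  have hn : 1 ≤ (ℓ + 1) ^ k := Nat.one_le_pow _ _ (Nat.succ_pos ℓ)
  have hS : IsUnit (B4GaugeCovariance.scalarOp (boxWt ((ℓ + 1) ^ k) (fun i => (ℓ + 1) ^ k * M i)) m2
      (B1.aSeq a ((ℓ : ℝ) + 1) k * (((((ℓ + 1) ^ k : ℕ)) : ℝ) ^ (d + 1))⁻¹)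
      (blkWt ((ℓ + 1) ^ k) M (fun i => (ℓ + 1) ^ k * M i))).det := by
    rw [B4GaugeCovariance.scalarOp_box hn]
    exact B4BoxCov237.boxOpR_det_isUnit hn hak hm hM
  have hg : IsGauge (fun u : ↥(Box d ℓ k M) => F.U (κ * linGauge A₀ Subtype.val u)) := F.isGauge _
  have hG : greenA0 d F κ ℓ k a m2 M emb Γ A₀
      = blockDiag (fun u : ↥(Box d ℓ k M) => F.U (κ * linGauge A₀ Subtype.val u))
          * (gk d ℓ k a m2 M ⊗ₖ (1 : Matrix ι ι ℝ))
          * (blockDiag fun u : ↥(Box d ℓ k M) => F.U (κ * linGauge A₀ Subtype.val u))ᵀ := by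
    dsimp only [greenA0]
    rw [B4GaugeCovariance.b4Green_constBond F κ _ m2 _ hend A₀ _ hS, B4GaugeCovariance.scalarOp_box hn]
  have hDer : derivA0 d F κ ℓ k M A₀ ν
      = blockDiag (fun u : ↥(Box d ℓ k M) => F.U (κ * linGauge A₀ Subtype.val u))
          * (dk d ℓ k M ν ⊗ₖ (1 : Matrix ι ι ℝ))
          * (blockDiag fun u : ↥(Box d ℓ k M) => F.U (κ * linGauge A₀ Subtype.val u))ᵀ := by
    dsimp only [derivA0]
    rw [covDeriv_constBond]
  rw [hG, hDer, mulVec_mulVec, B4Lemma22ReduceZero.conj_mul_conj hg, ← Matrix.mul_assoc (dk d ℓ k M ν ⊗ₖ _),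
    ← mul_kronecker_mul, Matrix.mul_one, ← Matrix.mul_assoc]
  exact siteNorm_conj_kron_mulVec_le hg _ f x

end Lift

/-! ## §5 The cross term at a site WITHOUT a boundary hypothesis: first-order part, interior divergence part and the
boundary-layer (lone-face) part -/

section Cross

variable {ι : Type} [Fintype ι] [DecidableEq ι] {d : ℕ}

/-- **THE DIVERGENCE PART MINUS ITS LONE FACE TERMS IS ZEROTH-ORDER SMALL**: in one direction `μ`, at a site `z` with
BOTH `μ`-neighbours in the box the two terms regroup into `E`-differences at the parallel consecutive bonds
`(z−e_μ,z), (z,z+e_μ)` (both orientations), `≤ 2ℓθ′/n²·|u(z)|` under the DERIVATIVE bound `|κ(A′(b′) − A′(b))| ≤ θ′/n²`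
(lattice form of (2.23) «|∂^η_μA′| ≤ c′e^{β−1}»); at a site with a missing `μ`-neighbour the divergence term IS the lone
term and the difference vanishes — no hypothesis on `A′` at the faces is used.
[cite: Balaban1983RegularityDecay, p. 581 (2.32); p. 579 (2.23)] -/
theorem div_sub_lone_le (F : OrthFlow ι) {ℓ : ℝ} (hℓ : 0 ≤ ℓ)
    (hLip : ∀ t (v : ι → ℝ), ((F.U t - 1) *ᵥ v) ⬝ᵥ ((F.U t - 1) *ᵥ v) ≤ (ℓ * t) ^ 2 * (v ⬝ᵥ v))
    (κ : ℝ) (n : ℕ) (N : Fin (d + 1) → ℕ) {A' : ↥(boxDom N) → ↥(boxDom N) → ℝ} {θ' : ℝ} (hθ' : 0 ≤ θ')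
    (hder : ∀ (x z y : ↥(boxDom N)) (μ : Fin (d + 1)), z.1 = x.1 + e1 μ → y.1 = z.1 + e1 μ →
      |κ * (A' y z - A' z x)| ≤ θ' / (n : ℝ) ^ 2 ∧ |κ * (A' x z - A' z y)| ≤ θ' / (n : ℝ) ^ 2)
    (u : ↥(boxDom N) × ι → ℝ) (z : ↥(boxDom N)) (μ : Fin (d + 1)) :
    siteNorm (((if h : z.1 + e1 μ ∈ boxDom N then
        (pertE (fieldLink F κ A') ⟨_, h⟩ z - pertE (fieldLink F κ A') z ⟨_, h⟩) *ᵥ fld u z else 0)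
      + (if h : z.1 - e1 μ ∈ boxDom N then
        (pertE (fieldLink F κ A') ⟨_, h⟩ z - pertE (fieldLink F κ A') z ⟨_, h⟩) *ᵥ fld u z else 0))
      - ((if h : z.1 + e1 μ ∈ boxDom N then (if z.1 - e1 μ ∈ boxDom N then 0 else
          (pertE (fieldLink F κ A') ⟨_, h⟩ z - pertE (fieldLink F κ A') z ⟨_, h⟩) *ᵥ fld u z) else 0)
        + (if h : z.1 - e1 μ ∈ boxDom N then (if z.1 + e1 μ ∈ boxDom N then 0 else
          (pertE (fieldLink F κ A') ⟨_, h⟩ z - pertE (fieldLink F κ A') z ⟨_, h⟩) *ᵥ fld u z) else 0)))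
      ≤ 2 * (ℓ * (θ' / (n : ℝ) ^ 2)) * siteNorm (fld u z) := by
  have hu := siteNorm_nonneg (fld u z)
  have h0 : 0 ≤ 2 * (ℓ * (θ' / (n : ℝ) ^ 2)) * siteNorm (fld u z) := mul_nonneg (by positivity) hu
  by_cases hp : z.1 + e1 μ ∈ boxDom N <;> by_cases hm : z.1 - e1 μ ∈ boxDom N
  · rw [dif_pos hp, dif_pos hm, dif_pos hp, dif_pos hm, if_pos hm, if_pos hp, add_zero, sub_zero]
    have hzm : z.1 = (⟨z.1 - e1 μ, hm⟩ : ↥(boxDom N)).1 + e1 μ := (sub_add_cancel _ _).symm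
    obtain ⟨h1, h2⟩ := hder ⟨_, hm⟩ z ⟨_, hp⟩ μ hzm rfl
    have hre : (pertE (fieldLink F κ A') ⟨_, hp⟩ z - pertE (fieldLink F κ A') z ⟨_, hp⟩) *ᵥ fld u z
        + (pertE (fieldLink F κ A') ⟨_, hm⟩ z - pertE (fieldLink F κ A') z ⟨_, hm⟩) *ᵥ fld u z
        = (pertE (fieldLink F κ A') ⟨_, hp⟩ z - pertE (fieldLink F κ A') z ⟨_, hm⟩) *ᵥ fld u z
          + (pertE (fieldLink F κ A') ⟨_, hm⟩ z - pertE (fieldLink F κ A') z ⟨_, hp⟩) *ᵥ fld u z := by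
      simp only [sub_mulVec]; abel
    rw [hre]
    refine (siteNorm_add_le _ _).trans ?_
    have e₁ := pertE_sub_mulVec_le F hℓ hLip κ A' ⟨_, hp⟩ z z ⟨_, hm⟩ (fld u z)
    have e₂ := pertE_sub_mulVec_le F hℓ hLip κ A' ⟨_, hm⟩ z z ⟨_, hp⟩ (fld u z)
    nlinarith [mul_le_mul_of_nonneg_right (mul_le_mul_of_nonneg_left h1 hℓ) hu,
      mul_le_mul_of_nonneg_right (mul_le_mul_of_nonneg_left h2 hℓ) hu]
  · rw [dif_pos hp, dif_neg hm, dif_pos hp, dif_neg hm, if_neg hm, add_zero, sub_self, siteNorm_zero]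
    exact h0
  · rw [dif_neg hp, dif_pos hm, dif_neg hp, dif_pos hm, if_neg hp, zero_add, sub_self, siteNorm_zero]
    exact h0
  · rw [dif_neg hp, dif_neg hm, dif_neg hp, dif_neg hm, add_zero, sub_self, siteNorm_zero]
    exact h0

/-- `|κ(p − q)| ≤ |κp| + |κq|`. [folklore] -/
private theorem abs_mul_sub_le (κ p q : ℝ) : |κ * (p - q)| ≤ |κ * p| + |κ * q| := by
  rw [mul_sub]
  exact abs_sub _ _

/-- **THE LONE FACE TERMS ARE OF SIZE `θ/n` TIMES THE MISSING WEIGHT**: `≤ 4ℓθ/n·|u(z)|` under the SIZE bound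
`|κA′_b| ≤ θ/n` on nearest-neighbour bonds (both orientations of the one bond present enter; multiplied by the bond
weight `n²/2` this is the `O(nθ)` boundary-layer coefficient of the cross term when `A′` does not vanish at `∂□`).
[cite: Balaban1983RegularityDecay, p. 581 (2.32); p. 579 (2.23)] -/
theorem lone_le (F : OrthFlow ι) {ℓ : ℝ} (hℓ : 0 ≤ ℓ)
    (hLip : ∀ t (v : ι → ℝ), ((F.U t - 1) *ᵥ v) ⬝ᵥ ((F.U t - 1) *ᵥ v) ≤ (ℓ * t) ^ 2 * (v ⬝ᵥ v))
    (κ : ℝ) (n : ℕ) (N : Fin (d + 1) → ℕ) {A' : ↥(boxDom N) → ↥(boxDom N) → ℝ} {θ : ℝ} (hθ : 0 ≤ θ)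
    (hA' : ∀ x y : ↥(boxDom N), y.1 ∈ nbrs x.1 → |κ * A' x y| ≤ θ / n)
    (u : ↥(boxDom N) × ι → ℝ) (z : ↥(boxDom N)) (μ : Fin (d + 1)) :
    siteNorm ((if h : z.1 + e1 μ ∈ boxDom N then (if z.1 - e1 μ ∈ boxDom N then 0 else
          (pertE (fieldLink F κ A') ⟨_, h⟩ z - pertE (fieldLink F κ A') z ⟨_, h⟩) *ᵥ fld u z) else 0)
        + (if h : z.1 - e1 μ ∈ boxDom N then (if z.1 + e1 μ ∈ boxDom N then 0 else
          (pertE (fieldLink F κ A') ⟨_, h⟩ z - pertE (fieldLink F κ A') z ⟨_, h⟩) *ᵥ fld u z) else 0))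
      ≤ 4 * (ℓ * (θ / n)) * siteNorm (fld u z) := by
  have hu := siteNorm_nonneg (fld u z)
  have hb0 : 0 ≤ 2 * (ℓ * (θ / n)) * siteNorm (fld u z) := mul_nonneg (by positivity) hu
  -- a single face term, in either direction
  have hone : ∀ (w : ↥(boxDom N)), w.1 ∈ nbrs z.1 →
      siteNorm ((pertE (fieldLink F κ A') w z - pertE (fieldLink F κ A') z w) *ᵥ fld u z)
        ≤ 2 * (ℓ * (θ / n)) * siteNorm (fld u z) := by
    intro w hw
    refine (pertE_sub_mulVec_le F hℓ hLip κ A' w z z w (fld u z)).trans ?_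
    have h1 := hA' w z (nbrs_comm.1 hw)
    have h2 := hA' z w hw
    have h3 := abs_mul_sub_le κ (A' w z) (A' z w)
    nlinarith [mul_le_mul_of_nonneg_right (mul_le_mul_of_nonneg_left (h3.trans (add_le_add h1 h2)) hℓ) hu]
  have hp_nbr : z.1 + e1 μ ∈ nbrs z.1 := mem_nbrs.2 ⟨μ, Or.inl rfl⟩
  have hm_nbr : z.1 - e1 μ ∈ nbrs z.1 := mem_nbrs.2 ⟨μ, Or.inr rfl⟩
  refine (siteNorm_add_le _ _).trans ?_
  have hA : siteNorm (if h : z.1 + e1 μ ∈ boxDom N then (if z.1 - e1 μ ∈ boxDom N then 0 else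
      (pertE (fieldLink F κ A') ⟨_, h⟩ z - pertE (fieldLink F κ A') z ⟨_, h⟩) *ᵥ fld u z) else 0)
      ≤ 2 * (ℓ * (θ / n)) * siteNorm (fld u z) := by
    by_cases hp : z.1 + e1 μ ∈ boxDom N
    · rw [dif_pos hp]
      by_cases hm : z.1 - e1 μ ∈ boxDom N
      · rw [if_pos hm, siteNorm_zero]; exact hb0
      · rw [if_neg hm]; exact hone ⟨_, hp⟩ hp_nbr
    · rw [dif_neg hp, siteNorm_zero]; exact hb0
  have hB : siteNorm (if h : z.1 - e1 μ ∈ boxDom N then (if z.1 + e1 μ ∈ boxDom N then 0 else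
      (pertE (fieldLink F κ A') ⟨_, h⟩ z - pertE (fieldLink F κ A') z ⟨_, h⟩) *ᵥ fld u z) else 0)
      ≤ 2 * (ℓ * (θ / n)) * siteNorm (fld u z) := by
    by_cases hm : z.1 - e1 μ ∈ boxDom N
    · rw [dif_pos hm]
      by_cases hp : z.1 + e1 μ ∈ boxDom N
      · rw [if_pos hp, siteNorm_zero]; exact hb0
      · rw [if_neg hp]; exact hone ⟨_, hm⟩ hm_nbr
    · rw [dif_neg hm, siteNorm_zero]; exact hb0
  linarith

/-- the lone face terms vanish at a site with all its `2(d+1)` lattice neighbours in the box. [folklore] -/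
private theorem lone_eq_zero (F : OrthFlow ι) (κ : ℝ) (N : Fin (d + 1) → ℕ) (A' : ↥(boxDom N) → ↥(boxDom N) → ℝ)
    (u : ↥(boxDom N) × ι → ℝ) (z : ↥(boxDom N))
    (hz : ¬ (∃ μ, z.1 + e1 μ ∉ boxDom N ∨ z.1 - e1 μ ∉ boxDom N)) (μ : Fin (d + 1)) :
    ((if h : z.1 + e1 μ ∈ boxDom N then (if z.1 - e1 μ ∈ boxDom N then 0 else
          (pertE (fieldLink F κ A') ⟨_, h⟩ z - pertE (fieldLink F κ A') z ⟨_, h⟩) *ᵥ fld u z) else 0)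
        + (if h : z.1 - e1 μ ∈ boxDom N then (if z.1 + e1 μ ∈ boxDom N then 0 else
          (pertE (fieldLink F κ A') ⟨_, h⟩ z - pertE (fieldLink F κ A') z ⟨_, h⟩) *ᵥ fld u z) else 0))
      = 0 := by
  push Not at hz
  obtain ⟨hp, hm⟩ := hz μ
  rw [dif_pos hp, if_pos hm, dif_pos hm, if_pos hp, add_zero]

/-- **THE CROSS TERM AT A SITE = FIRST-ORDER PART + `(n²/2)·Σ_μ` DIVERGENCE TERMS** (the typed (2.32), both
neighbours of each direction regrouped; `B4Lemma22CrossSup.cross_site_eq` + `sum_box_nbrs`).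
[cite: Balaban1983RegularityDecay, p. 581 (2.32)] -/
theorem cross_fld_eq (F : OrthFlow ι) (κ : ℝ) (n : ℕ) (N : Fin (d + 1) → ℕ)
    (A₀ : ↥(boxDom N) → ↥(boxDom N) → ℝ) (hanti : ∀ x y, A₀ y x = -A₀ x y)
    (A' : ↥(boxDom N) → ↥(boxDom N) → ℝ) (u : ↥(boxDom N) × ι → ℝ) (z : ↥(boxDom N)) :
    fld (crossOp (boxWt n N) (fieldLink F κ A₀) (pertE (fieldLink F κ A')) *ᵥ u) z
      = ∑ y, boxWt n N z y • (pertE (fieldLink F κ A') y z *ᵥ (fieldLink F κ A₀ z y *ᵥ fld u y - fld u z))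
        + ((n : ℝ) ^ 2 / 2) • ∑ μ, ((if h : z.1 + e1 μ ∈ boxDom N then
            (pertE (fieldLink F κ A') ⟨_, h⟩ z - pertE (fieldLink F κ A') z ⟨_, h⟩) *ᵥ fld u z else 0)
          + (if h : z.1 - e1 μ ∈ boxDom N then
            (pertE (fieldLink F κ A') ⟨_, h⟩ z - pertE (fieldLink F κ A') z ⟨_, h⟩) *ᵥ fld u z else 0)) := by
  rw [cross_site_eq F κ n N A₀ hanti A' u z]
  congr 1
  have hw : ∀ y, boxWt n N z y • ((pertE (fieldLink F κ A') y z - pertE (fieldLink F κ A') z y) *ᵥ fld u z)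
      = ((n : ℝ) ^ 2 / 2) • (if y.1 ∈ nbrs z.1 then
          (pertE (fieldLink F κ A') y z - pertE (fieldLink F κ A') z y) *ᵥ fld u z else 0) := by
    intro y
    unfold boxWt
    split_ifs <;> simp
  simp_rw [hw]
  rw [← Finset.smul_sum, sum_box_nbrs N z
    (fun y => (pertE (fieldLink F κ A') y z - pertE (fieldLink F κ A') z y) *ᵥ fld u z)]

end Cross

/-! ## §6 THE HEADLINE: `D^η_{A₀,ν}G_k(□,A₀)` applied to the cross term, at points far from `∂□`, for a
perturbation `A′` that is regular on `□` but NOT compactly supported in it -/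

section Main

variable {ι : Type} [Fintype ι] [DecidableEq ι]

/-- **(2.32) AT INTERIOR POINTS WITHOUT «A′ HAS A COMPACT SUPPORT IN □»**.  There are `δ₁, C > 0` (depending on
`d ≥ 1`, `L = ℓ + 1` and the window `[a₋,a₊] × [0,m²₊]` only) such that for every scale `k ≥ 1` (`n = L^k`), every point
of the window, every box `□ = Π_μ[0, M_μ)` (fine box `Π_μ[0, nM_μ)`), every contour system ending at the averaged point,
every constant configuration `A₀`, every coupling `κ`, and every perturbation `A′` with the SIZE bound
`|κA′_b| ≤ θ/n` on nearest-neighbour bonds and the DERIVATIVE bound `|κ(A′(b′) − A′(b))| ≤ θ′/n²` on consecutive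
parallel bonds (the lattice forms of (2.23) «|A′|, |∂^η_μA′| ≤ c′e^{β−1}»; NO condition at the faces of `□`), for every
depth `R ≥ 1`, every fine site `x` all of whose coordinates are at least `R·n` away from both faces (`dist(x, □ᶜ) ≥ R`
in the print's units), every direction `ν` and every `N`-component field `Ψ`:
`|(D^η_{A₀,ν} G_k(□,A₀) C Ψ)(x)| ≤ C·ℓ_F·(θ·Σ_μ‖D^η_{A₀,μ}Ψ‖_∞ + θ′·‖Ψ‖_∞ + θ·e^{−δ₁R}·‖Ψ‖_∞)`,
where `C = crossOp` is the cross term `D^{η*}_{A₀}F_{1,k}(−A′)` of (2.24) in the lineage's form, `G_k(□,A₀) = greenA0`,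
`D^η_{A₀,μ} = derivA0` (`B4Lemma22ReduceZero`) and `ℓ_F` is the Lipschitz constant of the flow.  The first two terms are
the printed «first order differential operator with small coefficients» (interior regrouping (2.32), bounded through
Lemma 2.2 (2.17)_∞ at `A₀`); the third is the boundary-layer part that (2.32) avoids by the assumption «Ã is constant in
a neighbourhood of ∂□» — here it is kept and bounded by the pointwise kernel estimate of the p. 583 Remark summed over
the faces (§3).  HONEST LABEL: our corollary of the printed route for fields not constant near `∂□`, serving [B2] p. 572
«and similarly for the derivative» (cell GAPS G-B2-04); not a quotation.
[cite: Balaban1983RegularityDecay, p. 581 (2.32); Lemma 2.2 (2.17) p. 578; p. 583 Remark] -/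
theorem deriv_green_cross_le (F : OrthFlow ι) {ℓF : ℝ} (hℓF : 0 ≤ ℓF)
    (hLip : ∀ t (v : ι → ℝ), ((F.U t - 1) *ᵥ v) ⬝ᵥ ((F.U t - 1) *ᵥ v) ≤ (ℓF * t) ^ 2 * (v ⬝ᵥ v))
    (d ℓ : ℕ) (hd : 1 ≤ d) (hℓ : 1 ≤ ℓ) (amin aplus m2plus : ℝ) (ha : 0 < amin) :
    ∃ δ₁ C : ℝ, 0 < δ₁ ∧ 0 < C ∧ ∀ (k : ℕ), 1 ≤ k → ∀ (a m2 : ℝ), amin ≤ a → a ≤ aplus → 0 ≤ m2 → m2 ≤ m2plus →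
      ∀ (M : Fin (d + 1) → ℕ), (∀ i, 1 ≤ M i) →
      ∀ (emb : ↥(boxDom M) → ↥(Box d ℓ k M)) (Γ : ↥(boxDom M) → ↥(Box d ℓ k M) → List ↥(Box d ℓ k M)),
        (∀ y x, blkWt ((ℓ + 1) ^ k) M (fun i => (ℓ + 1) ^ k * M i) y x ≠ 0 → pathEnd (emb y) (Γ y x) = x) →
      ∀ (A₀ : Fin (d + 1) → ℝ) (κ θ θ' : ℝ), 0 ≤ θ → 0 ≤ θ' →
      ∀ (A' : ↥(Box d ℓ k M) → ↥(Box d ℓ k M) → ℝ),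
        (∀ x y : ↥(Box d ℓ k M), y.1 ∈ nbrs x.1 → |κ * A' x y| ≤ θ / ((ℓ + 1) ^ k : ℕ)) →
        (∀ (x z y : ↥(Box d ℓ k M)) (μ : Fin (d + 1)), z.1 = x.1 + e1 μ → y.1 = z.1 + e1 μ →
          |κ * (A' y z - A' z x)| ≤ θ' / ((((ℓ + 1) ^ k : ℕ) : ℝ)) ^ 2 ∧
          |κ * (A' x z - A' z y)| ≤ θ' / ((((ℓ + 1) ^ k : ℕ) : ℝ)) ^ 2) →
      ∀ (R : ℕ), 1 ≤ R → ∀ (x : ↥(Box d ℓ k M)),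
        (∀ i, ((R * (ℓ + 1) ^ k : ℕ) : ℤ) ≤ x.1 i ∧
          x.1 i + (R * (ℓ + 1) ^ k : ℕ) + 1 ≤ (((ℓ + 1) ^ k * M i : ℕ) : ℤ)) →
      ∀ (ν : Fin (d + 1)) (Ψ : ↥(Box d ℓ k M) × ι → ℝ),
        siteNorm (fld (derivA0 d F κ ℓ k M A₀ ν *ᵥ (greenA0 d F κ ℓ k a m2 M emb Γ A₀ *ᵥ
          (crossOp (boxWt ((ℓ + 1) ^ k) (fun i => (ℓ + 1) ^ k * M i)) (fieldLink F κ (constBond A₀ Subtype.val))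
            (pertE (fieldLink F κ A')) *ᵥ Ψ))) x)
        ≤ C * ℓF * (θ * ∑ μ, supN (derivA0 d F κ ℓ k M A₀ μ *ᵥ Ψ) + θ' * supN Ψ
            + θ * Real.exp (-(δ₁ * R)) * supN Ψ) := by
  classical
  obtain ⟨c₂, hc₂, hrow⟩ := B4Thm110ZeroBoxDeriv.lemma22_zero_box_deriv_rowSum d ℓ hℓ amin aplus m2plus ha
  obtain ⟨δ₁, Cb, hδ₁, hCb, hbd⟩ := bdry_kernel_sum_le d ℓ hd hℓ amin aplus m2plus ha
  refine ⟨δ₁, ((d : ℝ) + 1) * (c₂ + 2 * Cb), hδ₁, by positivity, ?_⟩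
  intro k hk a m2 h1 h2 h3 h4 M hM emb Γ hend A₀ κ θ θ' hθ hθ' A' hA' hder R hR x hx ν Ψ
  -- names
  have hn1 : 1 ≤ (ℓ + 1) ^ k := Nat.one_le_pow _ _ (by omega)
  have hn0 : (0 : ℝ) < (((ℓ + 1) ^ k : ℕ) : ℝ) := by exact_mod_cast hn1
  have hnne : (((ℓ + 1) ^ k : ℕ) : ℝ) ≠ 0 := hn0.ne'
  have ha0 : 0 < a := lt_of_lt_of_le ha h1
  set n : ℕ := (ℓ + 1) ^ k with hn
  set E := pertE (fieldLink F κ A') with hE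
  set S := dk d ℓ k M ν * gk d ℓ k a m2 M with hS
  set T : ℝ := ∑ μ, supN (derivA0 d F κ ℓ k M A₀ μ *ᵥ Ψ) with hT
  have hT0 : 0 ≤ T := Finset.sum_nonneg fun μ _ => supN_nonneg _
  have hΨ0 : 0 ≤ supN Ψ := supN_nonneg Ψ
  -- the lone face terms and the face field
  set lone : Fin (d + 1) → ↥(Box d ℓ k M) → (ι → ℝ) := fun μ z =>
    (if h : z.1 + e1 μ ∈ Box d ℓ k M then (if z.1 - e1 μ ∈ Box d ℓ k M then 0 else
        (E ⟨_, h⟩ z - E z ⟨_, h⟩) *ᵥ fld Ψ z) else 0)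
      + (if h : z.1 - e1 μ ∈ Box d ℓ k M then (if z.1 + e1 μ ∈ Box d ℓ k M then 0 else
        (E ⟨_, h⟩ z - E z ⟨_, h⟩) *ᵥ fld Ψ z) else 0) with hlone
  set dv : Fin (d + 1) → ↥(Box d ℓ k M) → (ι → ℝ) := fun μ z =>
    (if h : z.1 + e1 μ ∈ Box d ℓ k M then (E ⟨_, h⟩ z - E z ⟨_, h⟩) *ᵥ fld Ψ z else 0)
      + (if h : z.1 - e1 μ ∈ Box d ℓ k M then (E ⟨_, h⟩ z - E z ⟨_, h⟩) *ᵥ fld Ψ z else 0) with hdv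
  set faceV : ↥(Box d ℓ k M) → (ι → ℝ) := fun z => ((n : ℝ) ^ 2 / 2) • ∑ μ, lone μ z with hfaceV
  set Fc : ↥(Box d ℓ k M) × ι → ℝ := fun p => faceV p.1 p.2 with hFc
  have hfldFc : ∀ z, fld Fc z = faceV z := fun z => rfl
  set CΨ := crossOp (boxWt ((ℓ + 1) ^ k) (fun i => (ℓ + 1) ^ k * M i))
    (fieldLink F κ (constBond A₀ Subtype.val)) E *ᵥ Ψ with hCΨ
  -- sitewise bounds on the pieces
  have hlone_le : ∀ μ z, siteNorm (lone μ z) ≤ 4 * (ℓF * (θ / n)) * siteNorm (fld Ψ z) := fun μ z =>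
    lone_le F hℓF hLip κ n _ hθ hA' Ψ z μ
  have hlone_zero : ∀ z : ↥(Box d ℓ k M), ¬ (∃ μ, z.1 + e1 μ ∉ Box d ℓ k M ∨ z.1 - e1 μ ∉ Box d ℓ k M) →
      ∀ μ, lone μ z = 0 := fun z hz μ => lone_eq_zero F κ _ A' Ψ z hz μ
  have hdv_le : ∀ μ z, siteNorm (dv μ z - lone μ z) ≤ 2 * (ℓF * (θ' / (n : ℝ) ^ 2)) * siteNorm (fld Ψ z) :=
    fun μ z => div_sub_lone_le F hℓF hLip κ n _ hθ' hder Ψ z μ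
  have hface_le : ∀ z, siteNorm (faceV z) ≤ 2 * ((d : ℝ) + 1) * ℓF * n * θ * supN Ψ := by
    intro z
    rw [hfaceV]
    dsimp only
    rw [siteNorm_smul, abs_of_nonneg (by positivity)]
    calc (n : ℝ) ^ 2 / 2 * siteNorm (∑ μ, lone μ z)
        ≤ (n : ℝ) ^ 2 / 2 * ∑ μ, 4 * (ℓF * (θ / n)) * siteNorm (fld Ψ z) :=
          mul_le_mul_of_nonneg_left ((siteNorm_sum_le _ _).trans (Finset.sum_le_sum fun μ _ => hlone_le μ z))
            (by positivity)
      _ ≤ (n : ℝ) ^ 2 / 2 * ∑ _μ : Fin (d + 1), 4 * (ℓF * (θ / n)) * supN Ψ := by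
          refine mul_le_mul_of_nonneg_left (Finset.sum_le_sum fun μ _ => ?_) (by positivity)
          exact mul_le_mul_of_nonneg_left (le_supN Ψ z) (by positivity)
      _ = 2 * ((d : ℝ) + 1) * ℓF * n * θ * supN Ψ := by
          rw [Finset.sum_const, Finset.card_univ, Fintype.card_fin, nsmul_eq_mul]
          push_cast
          field_simp
          ring
  have hface_zero : ∀ z : ↥(Box d ℓ k M), ¬ (∃ μ, z.1 + e1 μ ∉ Box d ℓ k M ∨ z.1 - e1 μ ∉ Box d ℓ k M) →
      faceV z = 0 := by
    intro z hz
    rw [hfaceV]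
    dsimp only
    rw [Finset.sum_eq_zero fun μ _ => hlone_zero z hz μ, smul_zero]
  -- the interior field `CΨ − Fc` sitewise
  have hint : ∀ z, siteNorm (fld (CΨ - Fc) z)
      ≤ ((d : ℝ) + 1) * ℓF * θ * T + ((d : ℝ) + 1) * ℓF * θ' * supN Ψ := by
    intro z
    have hfz : fld (CΨ - Fc) z = fld CΨ z - faceV z := rfl
    rw [hfz, hCΨ, cross_fld_eq F κ _ _ (constBond A₀ Subtype.val) (constBond_antisymm A₀ Subtype.val) A' Ψ z]
    have hre : ∑ y, boxWt ((ℓ + 1) ^ k) (fun i => (ℓ + 1) ^ k * M i) z y •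
          (E y z *ᵥ (fieldLink F κ (constBond A₀ Subtype.val) z y *ᵥ fld Ψ y - fld Ψ z))
        + ((((ℓ + 1) ^ k : ℕ) : ℝ) ^ 2 / 2) • ∑ μ, dv μ z - faceV z
        = ∑ y, boxWt ((ℓ + 1) ^ k) (fun i => (ℓ + 1) ^ k * M i) z y •
          (E y z *ᵥ (fieldLink F κ (constBond A₀ Subtype.val) z y *ᵥ fld Ψ y - fld Ψ z))
          + ((n : ℝ) ^ 2 / 2) • ∑ μ, (dv μ z - lone μ z) := by
      rw [hfaceV]
      dsimp only
      rw [Finset.sum_sub_distrib, smul_sub, add_sub_assoc]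
    rw [show (∑ μ, ((if h : z.1 + e1 μ ∈ Box d ℓ k M then (E ⟨_, h⟩ z - E z ⟨_, h⟩) *ᵥ fld Ψ z else 0)
        + (if h : z.1 - e1 μ ∈ Box d ℓ k M then (E ⟨_, h⟩ z - E z ⟨_, h⟩) *ᵥ fld Ψ z else 0)))
        = ∑ μ, dv μ z from rfl, hre]
    refine (siteNorm_add_le _ _).trans (add_le_add ?_ ?_)
    · have h := cross_first_le F hℓF hLip κ hn1 _ (constBond A₀ Subtype.val) (constBond_antisymm A₀ Subtype.val)
        hθ hA' Ψ z
      rw [hT]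
      exact h
    · rw [siteNorm_smul, abs_of_nonneg (by positivity)]
      calc (n : ℝ) ^ 2 / 2 * siteNorm (∑ μ, (dv μ z - lone μ z))
          ≤ (n : ℝ) ^ 2 / 2 * ∑ μ, 2 * (ℓF * (θ' / (n : ℝ) ^ 2)) * siteNorm (fld Ψ z) :=
            mul_le_mul_of_nonneg_left ((siteNorm_sum_le _ _).trans (Finset.sum_le_sum fun μ _ => hdv_le μ z))
              (by positivity)
        _ ≤ (n : ℝ) ^ 2 / 2 * ∑ _μ : Fin (d + 1), 2 * (ℓF * (θ' / (n : ℝ) ^ 2)) * supN Ψ := by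
            refine mul_le_mul_of_nonneg_left (Finset.sum_le_sum fun μ _ => ?_) (by positivity)
            exact mul_le_mul_of_nonneg_left (le_supN Ψ z) (by positivity)
        _ = ((d : ℝ) + 1) * ℓF * θ' * supN Ψ := by
            rw [Finset.sum_const, Finset.card_univ, Fintype.card_fin, nsmul_eq_mul]
            push_cast
            field_simp
  have hd0 : (0 : ℝ) ≤ (d : ℝ) + 1 := by positivity
  have hB0 : 0 ≤ ((d : ℝ) + 1) * ℓF * θ * T + ((d : ℝ) + 1) * ℓF * θ' * supN Ψ :=
    add_nonneg (mul_nonneg (mul_nonneg (mul_nonneg hd0 hℓF) hθ) hT0)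
      (mul_nonneg (mul_nonneg (mul_nonneg hd0 hℓF) hθ') hΨ0)
  -- row sums of the scalar kernel
  have hrowS : ∑ z, |S x z| ≤ c₂ := by
    rw [hS]
    exact B4Lemma22ReduceZero.rowSum_fdiffM_mul_le _ hc₂.le
      (fun x' xe hxe => hrow k hk a m2 h1 h2 h3 h4 M hM ν x' xe hxe) x
  -- (i) the interior part
  have hI : siteNorm (fld (derivA0 d F κ ℓ k M A₀ ν *ᵥ (greenA0 d F κ ℓ k a m2 M emb Γ A₀ *ᵥ (CΨ - Fc))) x)
      ≤ c₂ * (((d : ℝ) + 1) * ℓF * θ * T + ((d : ℝ) + 1) * ℓF * θ' * supN Ψ) := by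
    refine (deriv_green_site_le F κ hℓ hk ha0 h3 hM hend A₀ ν (CΨ - Fc) x).trans ?_
    calc ∑ z, |S x z| * siteNorm (fld (CΨ - Fc) z)
        ≤ ∑ z, |S x z| * (((d : ℝ) + 1) * ℓF * θ * T + ((d : ℝ) + 1) * ℓF * θ' * supN Ψ) :=
          Finset.sum_le_sum fun z _ => mul_le_mul_of_nonneg_left (hint z) (abs_nonneg _)
      _ = (∑ z, |S x z|) * (((d : ℝ) + 1) * ℓF * θ * T + ((d : ℝ) + 1) * ℓF * θ' * supN Ψ) := by
          rw [Finset.sum_mul]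
      _ ≤ c₂ * (((d : ℝ) + 1) * ℓF * θ * T + ((d : ℝ) + 1) * ℓF * θ' * supN Ψ) :=
          mul_le_mul_of_nonneg_right hrowS hB0
  -- (ii) the boundary-layer part
  have hRn : 1 ≤ R * n := by
    have := Nat.mul_le_mul hR hn1
    simpa using this
  have hxe_mem : x.1 + e1 ν ∈ Box d ℓ k M := add_e1_mem_of_deep hRn hx ν
  have hSxz : ∀ z, |S x z| = (n : ℝ) * |gk d ℓ k a m2 M ⟨x.1 + e1 ν, hxe_mem⟩ z - gk d ℓ k a m2 M x z| := by
    intro z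
    rw [hS]
    dsimp only [dk]
    rw [B4Lemma22ReduceZero.fdiffM_mul_apply_of_mem _ hxe_mem z, abs_mul, Nat.abs_cast]
    rfl
  have hII : siteNorm (fld (derivA0 d F κ ℓ k M A₀ ν *ᵥ (greenA0 d F κ ℓ k a m2 M emb Γ A₀ *ᵥ Fc)) x)
      ≤ 2 * Cb * ((d : ℝ) + 1) * ℓF * θ * Real.exp (-(δ₁ * R)) * supN Ψ := by
    refine (deriv_green_site_le F κ hℓ hk ha0 h3 hM hend A₀ ν Fc x).trans ?_
    have hkey := hbd k hk a m2 h1 h2 h3 h4 M hM R hR ν x ⟨x.1 + e1 ν, hxe_mem⟩ rfl hx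
    calc ∑ z, |S x z| * siteNorm (fld Fc z)
        ≤ ∑ z : ↥(Box d ℓ k M), (if (∃ μ, z.1 + e1 μ ∉ Box d ℓ k M ∨ z.1 - e1 μ ∉ Box d ℓ k M) then
            (n : ℝ) * |gk d ℓ k a m2 M ⟨x.1 + e1 ν, hxe_mem⟩ z - gk d ℓ k a m2 M x z| else 0)
            * (2 * ((d : ℝ) + 1) * ℓF * n * θ * supN Ψ) := by
          refine Finset.sum_le_sum fun z _ => ?_
          rw [hfldFc]
          split_ifs with hz
          · rw [hSxz]
            exact mul_le_mul_of_nonneg_left (hface_le z) (mul_nonneg (Nat.cast_nonneg n) (abs_nonneg _))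
          · rw [hface_zero z hz, siteNorm_zero, mul_zero, zero_mul]
      _ = (∑ z : ↥(Box d ℓ k M), (if (∃ μ, z.1 + e1 μ ∉ Box d ℓ k M ∨ z.1 - e1 μ ∉ Box d ℓ k M) then
            (n : ℝ) * |gk d ℓ k a m2 M ⟨x.1 + e1 ν, hxe_mem⟩ z - gk d ℓ k a m2 M x z| else 0))
            * (2 * ((d : ℝ) + 1) * ℓF * n * θ * supN Ψ) := by rw [Finset.sum_mul]
      _ ≤ (Cb * ((n : ℝ))⁻¹ * Real.exp (-(δ₁ * R))) * (2 * ((d : ℝ) + 1) * ℓF * n * θ * supN Ψ) :=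
          mul_le_mul_of_nonneg_right hkey
            (mul_nonneg (mul_nonneg (mul_nonneg (mul_nonneg (by positivity) hℓF) (Nat.cast_nonneg n)) hθ) hΨ0)
      _ = 2 * Cb * ((d : ℝ) + 1) * ℓF * θ * Real.exp (-(δ₁ * R)) * supN Ψ := by
          field_simp
  -- assembling
  have hsplit : derivA0 d F κ ℓ k M A₀ ν *ᵥ (greenA0 d F κ ℓ k a m2 M emb Γ A₀ *ᵥ CΨ)
      = derivA0 d F κ ℓ k M A₀ ν *ᵥ (greenA0 d F κ ℓ k a m2 M emb Γ A₀ *ᵥ (CΨ - Fc))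
        + derivA0 d F κ ℓ k M A₀ ν *ᵥ (greenA0 d F κ ℓ k a m2 M emb Γ A₀ *ᵥ Fc) := by
    rw [← mulVec_add, ← mulVec_add, sub_add_cancel]
  rw [hsplit, fld_add]
  refine (siteNorm_add_le _ _).trans ((add_le_add hI hII).trans ?_)
  have hexp0 : 0 ≤ Real.exp (-(δ₁ * R)) := (Real.exp_pos _).le
  nlinarith [mul_nonneg hc₂.le hT0, mul_nonneg hCb.le hΨ0, mul_nonneg hℓF hθ, mul_nonneg hℓF hθ',
    mul_nonneg (mul_nonneg (mul_nonneg hCb.le hℓF) hθ) (mul_nonneg hT0 hΨ0),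
    mul_nonneg (mul_nonneg (mul_nonneg hc₂.le hℓF) hθ) (mul_nonneg hexp0 hΨ0),
    mul_nonneg (mul_nonneg (mul_nonneg hCb.le hℓF) hθ') hΨ0,
    mul_nonneg (mul_nonneg (mul_nonneg hCb.le hℓF) hθ) hT0]

/-- **THE SAME BOUND MEASURED WITH THE COVARIANT DERIVATIVES OF THE FIELD `Ã = A₀ + A′` ITSELF** («the
decomposition D^η_Ã = U(A′)D^η_{A₀} + F_{1,k}(A′)», tree: `B4Lemma22ReduceDeriv.covDeriv_sub_supN_le_nbrs`,
`‖(D^η_{Ã,μ} − D^η_{A₀,μ})Ψ‖_∞ ≤ ℓ_Fθ‖Ψ‖_∞`): with `T′ = Σ_μ‖D^η_{Ã,μ}Ψ‖_∞`,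
`|(D^η_{A₀,ν}G_k(□,A₀)CΨ)(x)| ≤ C·ℓ_F·(θ·T′ + ((d+1)ℓ_Fθ² + θ′ + θe^{−δ₁R})·‖Ψ‖_∞)` — the shape in which [B2]'s
Lemma 2.4 supplies its inputs (Proposition I.2.2 for `G_k(□,A^{(k)})`: `‖g‖_∞`, `‖D^η_{A^{(k)}}g‖_∞`).
[cite: Balaban1983RegularityDecay, p. 581 (2.32)–(2.33); p. 580 «D^η_A = U(A′)D^η_{A₀} + F_{1,k}(A′)»] -/
theorem deriv_green_cross_le_field (F : OrthFlow ι) {ℓF : ℝ} (hℓF : 0 ≤ ℓF)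
    (hLip : ∀ t (v : ι → ℝ), ((F.U t - 1) *ᵥ v) ⬝ᵥ ((F.U t - 1) *ᵥ v) ≤ (ℓF * t) ^ 2 * (v ⬝ᵥ v))
    (d ℓ : ℕ) (hd : 1 ≤ d) (hℓ : 1 ≤ ℓ) (amin aplus m2plus : ℝ) (ha : 0 < amin) :
    ∃ δ₁ C : ℝ, 0 < δ₁ ∧ 0 < C ∧ ∀ (k : ℕ), 1 ≤ k → ∀ (a m2 : ℝ), amin ≤ a → a ≤ aplus → 0 ≤ m2 → m2 ≤ m2plus →
      ∀ (M : Fin (d + 1) → ℕ), (∀ i, 1 ≤ M i) →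
      ∀ (emb : ↥(boxDom M) → ↥(Box d ℓ k M)) (Γ : ↥(boxDom M) → ↥(Box d ℓ k M) → List ↥(Box d ℓ k M)),
        (∀ y x, blkWt ((ℓ + 1) ^ k) M (fun i => (ℓ + 1) ^ k * M i) y x ≠ 0 → pathEnd (emb y) (Γ y x) = x) →
      ∀ (A₀ : Fin (d + 1) → ℝ) (κ θ θ' : ℝ), 0 ≤ θ → 0 ≤ θ' →
      ∀ (A' : ↥(Box d ℓ k M) → ↥(Box d ℓ k M) → ℝ),
        (∀ x y : ↥(Box d ℓ k M), y.1 ∈ nbrs x.1 → |κ * A' x y| ≤ θ / ((ℓ + 1) ^ k : ℕ)) →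
        (∀ (x z y : ↥(Box d ℓ k M)) (μ : Fin (d + 1)), z.1 = x.1 + e1 μ → y.1 = z.1 + e1 μ →
          |κ * (A' y z - A' z x)| ≤ θ' / ((((ℓ + 1) ^ k : ℕ) : ℝ)) ^ 2 ∧
          |κ * (A' x z - A' z y)| ≤ θ' / ((((ℓ + 1) ^ k : ℕ) : ℝ)) ^ 2) →
      ∀ (R : ℕ), 1 ≤ R → ∀ (x : ↥(Box d ℓ k M)),
        (∀ i, ((R * (ℓ + 1) ^ k : ℕ) : ℤ) ≤ x.1 i ∧
          x.1 i + (R * (ℓ + 1) ^ k : ℕ) + 1 ≤ (((ℓ + 1) ^ k * M i : ℕ) : ℤ)) →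
      ∀ (ν : Fin (d + 1)) (Ψ : ↥(Box d ℓ k M) × ι → ℝ),
        siteNorm (fld (derivA0 d F κ ℓ k M A₀ ν *ᵥ (greenA0 d F κ ℓ k a m2 M emb Γ A₀ *ᵥ
          (crossOp (boxWt ((ℓ + 1) ^ k) (fun i => (ℓ + 1) ^ k * M i)) (fieldLink F κ (constBond A₀ Subtype.val))
            (pertE (fieldLink F κ A')) *ᵥ Ψ))) x)
        ≤ C * ℓF * (θ * ∑ μ, supN (derivA d F κ ℓ k M (constBond A₀ Subtype.val + A') μ *ᵥ Ψ)
            + (((d : ℝ) + 1) * ℓF * θ * θ + θ' + θ * Real.exp (-(δ₁ * R))) * supN Ψ) := by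
  obtain ⟨δ₁, C, hδ₁, hC, h⟩ := deriv_green_cross_le F hℓF hLip d ℓ hd hℓ amin aplus m2plus ha
  refine ⟨δ₁, C, hδ₁, hC, ?_⟩
  intro k hk a m2 h1 h2 h3 h4 M hM emb Γ hend A₀ κ θ θ' hθ hθ' A' hA' hder R hR x hx ν Ψ
  have hmain := h k hk a m2 h1 h2 h3 h4 M hM emb Γ hend A₀ κ θ θ' hθ hθ' A' hA' hder R hR x hx ν Ψ
  have hn1 : 1 ≤ (ℓ + 1) ^ k := Nat.one_le_pow _ _ (by omega)
  have hΨ0 : 0 ≤ supN Ψ := supN_nonneg Ψ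
  -- `‖D_{A₀,μ}Ψ‖_∞ ≤ ‖D_{Ã,μ}Ψ‖_∞ + ℓθ‖Ψ‖_∞`
  have hconv : ∀ μ, supN (derivA0 d F κ ℓ k M A₀ μ *ᵥ Ψ)
      ≤ supN (derivA d F κ ℓ k M (constBond A₀ Subtype.val + A') μ *ᵥ Ψ) + ℓF * θ * supN Ψ := by
    intro μ
    have hsub := B4Lemma22ReduceDeriv.covDeriv_sub_supN_le_nbrs F hℓF hLip κ hn1
      (constBond A₀ Subtype.val) hθ hA' μ Ψ
    have heq : derivA0 d F κ ℓ k M A₀ μ *ᵥ Ψ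
        = derivA d F κ ℓ k M (constBond A₀ Subtype.val + A') μ *ᵥ Ψ
          + -((derivA d F κ ℓ k M (constBond A₀ Subtype.val + A') μ - derivA0 d F κ ℓ k M A₀ μ) *ᵥ Ψ) := by
      rw [sub_mulVec]; abel
    rw [heq]
    refine (supN_add_le _ _).trans (add_le_add le_rfl ?_)
    rw [supN_neg]
    exact hsub
  have hT : ∑ μ, supN (derivA0 d F κ ℓ k M A₀ μ *ᵥ Ψ)
      ≤ ∑ μ, supN (derivA d F κ ℓ k M (constBond A₀ Subtype.val + A') μ *ᵥ Ψ)
        + ((d : ℝ) + 1) * (ℓF * θ * supN Ψ) := by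
    refine (Finset.sum_le_sum fun μ _ => hconv μ).trans (le_of_eq ?_)
    rw [Finset.sum_add_distrib, Finset.sum_const, Finset.card_univ, Fintype.card_fin, nsmul_eq_mul]
    push_cast
    ring
  have hT'0 : 0 ≤ ∑ μ, supN (derivA d F κ ℓ k M (constBond A₀ Subtype.val + A') μ *ᵥ Ψ) :=
    Finset.sum_nonneg fun μ _ => supN_nonneg _
  refine hmain.trans ?_
  have hCℓ : 0 ≤ C * ℓF := mul_nonneg hC.le hℓF
  have hstep : θ * ∑ μ, supN (derivA0 d F κ ℓ k M A₀ μ *ᵥ Ψ)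
      ≤ θ * ∑ μ, supN (derivA d F κ ℓ k M (constBond A₀ Subtype.val + A') μ *ᵥ Ψ)
        + ((d : ℝ) + 1) * ℓF * θ * θ * supN Ψ := by
    calc θ * ∑ μ, supN (derivA0 d F κ ℓ k M A₀ μ *ᵥ Ψ)
        ≤ θ * (∑ μ, supN (derivA d F κ ℓ k M (constBond A₀ Subtype.val + A') μ *ᵥ Ψ)
          + ((d : ℝ) + 1) * (ℓF * θ * supN Ψ)) := mul_le_mul_of_nonneg_left hT hθ
      _ = _ := by ring
  calc C * ℓF * (θ * ∑ μ, supN (derivA0 d F κ ℓ k M A₀ μ *ᵥ Ψ) + θ' * supN Ψ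
        + θ * Real.exp (-(δ₁ * R)) * supN Ψ)
      ≤ C * ℓF * (θ * ∑ μ, supN (derivA d F κ ℓ k M (constBond A₀ Subtype.val + A') μ *ᵥ Ψ)
        + ((d : ℝ) + 1) * ℓF * θ * θ * supN Ψ + θ' * supN Ψ + θ * Real.exp (-(δ₁ * R)) * supN Ψ) :=
        mul_le_mul_of_nonneg_left (by linarith) hCℓ
    _ = _ := by ring

end Main

end

end Literature.MathematicalPhysics.QuantumFieldTheory.Balaban1983to89.B4Eq232BoundaryLayer
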